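import Summits.NavierStokesRegularity.NavierStokesRegularity.Theses.DssFarFieldSlaving
import Summits.NavierStokesRegularity.NavierStokesRegularity.Theorems.QuantisedSymmetryPolyhedralDssProfileExistsStubAncientMildOfClassicalTypeI
import Literature.Analysis.FluidPDE.AncientSimilarityVariables
import Literature.Analysis.FluidPDE.HyperbolicDSSOrbit
import HarnessLib

/-!
# The instantiation bridge: a classical similarity-variable certificate IS a Type-I rotated-DSS
  ancient profile (route `DssFarFieldSlaving`, crux `BlowupTypeIDssProfile`,
  stmt-NavierStokesRegularity-0155 — SUPPORT, not a proof of the crux)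

The open crux `Theses.DssFarFieldSlaving.BlowupTypeIDssProfile` (= the failure of Tsai's Type-I
rotated `λ`-DSS Liouville wall; equivalently the antecedent of the PROVED truncation bridges
`filamentSkeletonRss_rdssProfileTruncation_proof` / `dssTruncationBridgeTypeI_proof`) asks for a
triple `(c, R, u)`: `1 < c`, `R` a linear isometry of `ℝ³`, `u` an ancient mild solution (`ν = 1`,
duality form) with measurable slices, rotated `c`-DSS for `R`, Type-I bounded
(`‖u(t,x)‖ ≤ C₀/(‖x‖ + √(−t))`) and not a.e. trivial.  Any search for such an object — numerical or
analytic — works with the smooth profile in backward similarity variables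
`U(s, y) = √(−t) u(t, √(−t) y)`, `s = −log(−t)`.  This file proves, from tree lemmas only, that
the following CLASSICAL CERTIFICATE suffices: `1 < c`; `(U, P)` a classical solution on all of
`ℝ × ℝ³` of the backward Leray system `∂ₛU + ½U + ½(y·∇)U + (U·∇)U + ∇P = ΔU`, `div U = 0`
(`IsBackwardLeraySolutionOn univ 1 U P`); the twisted periodicity `U(s + 2 log c, y) = R⁻¹ U(s, R y)`;
the profile Type-I bound `(1 + ‖y‖) ‖U(s, y)‖ ≤ C₀`; and `U(s₀, y₀) ≠ 0` somewhere.  The physical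
field is `u = ofLerayOrbit U` (which vanishes for `t ≥ 0`), and:

* `isRotatedDSS_ofLerayOrbit` — twisted periodicity ⇒ `IsRotatedDSS c R (ofLerayOrbit U)` at ALL
  times (the tree's `lerayOrbit_add_eq_symm_iff` on the past; both sides vanish for `t ≥ 0`);
* `lerayCertificate_isTypeIDSSProfile` — the certificate yields the structure
  `IsTypeIDSSProfile c R (ofLerayOrbit U)` (classical ⇒ KNSS-mild by the tree's
  `stub_ancientMild_of_classical_typeI`; measurability and non-triviality from continuity);
* `exists_rdssClass_of_lerayCertificate` — hence the literal `∃`-hypothesis of the truncation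
  bridges;
* `blowupTypeIDssProfile_of_lerayCertificate` — hence the crux.

Nothing here asserts that a certificate exists.

## References

* D. Chae, J. Wolf, Comm. PDE 42 (2017) = arXiv:1610.09464, §4 (similarity variables, DSS ⇔
  periodicity of the profile). [ChaeWolf2017RemovingDSS]
* Z. Bradshaw, T.-P. Tsai, Comm. PDE 42 (2017) = arXiv:1610.05680, §1 (RDSS), §5 Open Problem 5.1.
  [BradshawTsai2017CPDE]
* G. Koch, N. Nadirashvili, G. Seregin, V. Šverák, Acta Math. 203 (2009), Thm 6.1 (mildness of
  Type-I classical solutions). [KochNadirashviliSereginSverak2009]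
-/

noncomputable section

set_option linter.dupNamespace false

namespace Summit.NavierStokesRegularity.NavierStokesRegularity.Theorems

open MeasureTheory Set Function Literature.Analysis.FluidPDE

/-- **Twisted periodicity of the profile gives rotated discrete self-similarity of the physical
field at ALL times** (Chae–Wolf 2017 §4 / Bradshaw–Tsai 2017 §1, via the tree's
`lerayOrbit_add_eq_symm_iff` on the past; for `t ≥ 0` both sides of the identity are `0`).
[cite: BradshawTsai2017CPDE, §1 (rotated discretely self-similar fields)] -/
theorem isRotatedDSS_ofLerayOrbit {c : ℝ} (hc : 0 < c) {R : EuclideanSpace ℝ (Fin 3) ≃ₗᵢ[ℝ] EuclideanSpace ℝ (Fin 3)} {U : ℝ → EuclideanSpace ℝ (Fin 3) → EuclideanSpace ℝ (Fin 3)}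
    (hU : ∀ s y, U (s + 2 * Real.log c) y = R.symm (U s (R y))) :
    IsRotatedDSS c R (ofLerayOrbit U) := by
  -- the physical field of a profile is junk (`= 0`) at non-negative times (`√(−t) = 0`, `0⁻¹ = 0`);
  -- this is the tree's `NoSelfExcitedDynamo.Registered.rungDss_ofLerayOrbit_eq_zero_of_nonneg`,
  -- re-derived inline to keep the imports light
  have hzero : ∀ {t : ℝ}, 0 ≤ t → ∀ x, ofLerayOrbit U t x = 0 := fun {t} ht x => by
    rw [ofLerayOrbit_apply, Real.sqrt_eq_zero'.2 (neg_nonpos.2 ht), inv_zero, zero_smul]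
  intro t x
  rcases lt_or_ge t 0 with ht | ht
  · have hper : ∀ s y, lerayOrbit (ofLerayOrbit U) (s + 2 * Real.log c) y =
        R.symm (lerayOrbit (ofLerayOrbit U) s (R y)) := by
      intro s y
      rw [lerayOrbit_ofLerayOrbit_eq]
      exact hU s y
    exact (lerayOrbit_add_eq_symm_iff hc).1 hper t ht x
  · have hct : 0 ≤ c ^ 2 * t := by positivity
    rw [hzero hct, hzero ht, map_zero, smul_zero]

/-- **A classical similarity-variable certificate is a Type-I rotated-DSS ancient profile**
(`IsTypeIDSSProfile c R (ofLerayOrbit U)`): the backward Leray system on `ℝ × ℝ³` is classical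
Navier–Stokes on the past (`isClassicalNSSolutionOn_Iio_ofLerayOrbit_iff`), the profile bound is
the Type-I bound (`hasTypeIDecay_iff_lerayOrbit`), classical + Type-I ⇒ KNSS-mild ⇒ duality-mild
(`stub_ancientMild_of_classical_typeI`, KNSS 2009 Thm 6.1), slices are continuous hence
measurable, and a nonzero profile value gives a slice that is not a.e. zero (continuous functions
a.e. equal to `0` vanish identically). [cite: KochNadirashviliSereginSverak2009, Thm 6.1] -/
theorem lerayCertificate_isTypeIDSSProfile {c : ℝ} (hc : 1 < c) {R : EuclideanSpace ℝ (Fin 3) ≃ₗᵢ[ℝ] EuclideanSpace ℝ (Fin 3)}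
    {U : ℝ → EuclideanSpace ℝ (Fin 3) → EuclideanSpace ℝ (Fin 3)} {P : ℝ → EuclideanSpace ℝ (Fin 3) → ℝ} {C₀ : ℝ}
    (hL : IsBackwardLeraySolutionOn univ 1 U P)
    (hper : ∀ s y, U (s + 2 * Real.log c) y = R.symm (U s (R y)))
    (hI : ∀ s y, (1 + ‖y‖) * ‖U s y‖ ≤ C₀)
    (hnz : ∃ s₀ y₀, U s₀ y₀ ≠ 0) :
    IsTypeIDSSProfile c R (ofLerayOrbit U) := by
  have hcl : IsClassicalNSSolutionOn (Iio 0) 1 0 (ofLerayOrbit U) (ofLerayOrbitPressure P) :=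
    isClassicalNSSolutionOn_Iio_ofLerayOrbit_iff.2 hL
  have hTI : HasTypeIDecay C₀ (ofLerayOrbit U) := by
    rw [hasTypeIDecay_iff_lerayOrbit, lerayOrbit_ofLerayOrbit_eq]
    exact hI
  have hcont : ∀ t < 0, Continuous (ofLerayOrbit U t) := fun t ht =>
    (hcl.contDiff_velocity (show t ∈ Iio (0 : ℝ) from ht)).continuous
  refine
    { one_lt := hc
      isAncientMildSolution :=
        PolyhedralDssProfileExists.Birth.stub_ancientMild_of_classical_typeI _ _ _ hcl hTI
      aestronglyMeasurable := fun t ht => (hcont t ht).aestronglyMeasurable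
      isRotatedDSS := isRotatedDSS_ofLerayOrbit (by linarith) hper
      hasTypeIDecay := ⟨C₀, hTI⟩
      nontrivial := ?_
      smooth := hcl.smooth_velocity }
  obtain ⟨s₀, y₀, h0⟩ := hnz
  intro hae
  have ht₀ : -Real.exp (-s₀) < 0 := by simpa using Real.exp_pos (-s₀)
  have hzero : ofLerayOrbit U (-Real.exp (-s₀)) = 0 :=
    Measure.eq_of_ae_eq (hae _ ht₀) (hcont _ ht₀) continuous_const
  apply h0
  have e := congrFun (congrFun (lerayOrbit_ofLerayOrbit_eq U) s₀) y₀
  rw [← e, lerayOrbit_apply, hzero, Pi.zero_apply, smul_zero]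

/-- **The certificate yields the literal hypothesis of the truncation bridges** (the antecedent of
`Theses.FilamentSkeletonRss.RdssProfileTruncation` and, after `push_neg`, of
`Theses.DssFarFieldSlaving.DssTruncationBridgeTypeI`), witnessed by `u = ofLerayOrbit U`.
[cite: BradshawTsai2017CPDE, §5 Open Problem 5.1] -/
theorem exists_rdssClass_of_lerayCertificate
    (h : ∃ (c : ℝ) (R : EuclideanSpace ℝ (Fin 3) ≃ₗᵢ[ℝ] EuclideanSpace ℝ (Fin 3)) (U : ℝ → EuclideanSpace ℝ (Fin 3) → EuclideanSpace ℝ (Fin 3)) (P : ℝ → EuclideanSpace ℝ (Fin 3) → ℝ) (C₀ : ℝ),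
      1 < c ∧ IsBackwardLeraySolutionOn univ 1 U P ∧
      (∀ s y, U (s + 2 * Real.log c) y = R.symm (U s (R y))) ∧
      (∀ s y, (1 + ‖y‖) * ‖U s y‖ ≤ C₀) ∧ (∃ s₀ y₀, U s₀ y₀ ≠ 0)) :
    ∃ (c : ℝ) (R : EuclideanSpace ℝ (Fin 3) ≃ₗᵢ[ℝ] EuclideanSpace ℝ (Fin 3)) (u : ℝ → EuclideanSpace ℝ (Fin 3) → EuclideanSpace ℝ (Fin 3)),
      1 < c ∧ IsAncientMildSolution 1 u ∧ (∀ t < 0, AEStronglyMeasurable (u t) volume) ∧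
      IsRotatedDSS c R u ∧ (∃ C₀ : ℝ, HasTypeIDecay C₀ u) ∧ ¬ (∀ t < 0, u t =ᵐ[volume] 0) := by
  obtain ⟨c, R, U, P, C₀, hc, hL, hper, hI, hnz⟩ := h
  have hP := lerayCertificate_isTypeIDSSProfile hc hL hper hI hnz
  exact ⟨c, R, ofLerayOrbit U, hP.one_lt, hP.isAncientMildSolution, hP.aestronglyMeasurable,
    hP.isRotatedDSS, hP.hasTypeIDecay, hP.nontrivial⟩

/-- **Instantiation bridge for the crux `BlowupTypeIDssProfile`** (stmt-NavierStokesRegularity-0155):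
a classical similarity-variable certificate — `1 < c`, `R` any linear isometry of `ℝ³`, `(U, P)`
solving the backward Leray system `∂ₛU + ½U + ½(y·∇)U + (U·∇)U + ∇P = ΔU`, `div U = 0` on all of
`ℝ × ℝ³`, twisted-periodic `U(s + 2 log c, y) = R⁻¹ U(s, R y)`, with `(1 + ‖y‖)‖U(s,y)‖ ≤ C₀` and
`U ≢ 0` — refutes Tsai's Type-I rotated `λ`-DSS Liouville wall, i.e. proves the crux.  (The
rotated statement `RotatedTypeIDSSLiouville c R` applied to `ofLerayOrbit U` would force every
negative slice to vanish a.e.)  SUPPORT for the item: it reduces the crux to exhibiting ONE such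
certificate; it does not exhibit one. [cite: BradshawTsai2017CPDE, §5 Open Problem 5.1] -/
theorem blowupTypeIDssProfile_of_lerayCertificate
    (h : ∃ (c : ℝ) (R : EuclideanSpace ℝ (Fin 3) ≃ₗᵢ[ℝ] EuclideanSpace ℝ (Fin 3)) (U : ℝ → EuclideanSpace ℝ (Fin 3) → EuclideanSpace ℝ (Fin 3)) (P : ℝ → EuclideanSpace ℝ (Fin 3) → ℝ) (C₀ : ℝ),
      1 < c ∧ IsBackwardLeraySolutionOn univ 1 U P ∧
      (∀ s y, U (s + 2 * Real.log c) y = R.symm (U s (R y))) ∧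
      (∀ s y, (1 + ‖y‖) * ‖U s y‖ ≤ C₀) ∧ (∃ s₀ y₀, U s₀ y₀ ≠ 0)) :
    Theses.DssFarFieldSlaving.BlowupTypeIDssProfile := by
  obtain ⟨c, R, u, hc, hmild, hmeas, hrdss, hTI, hnz⟩ := exists_rdssClass_of_lerayCertificate h
  intro hwall
  exact hnz ((hwall c).2 R hc u hmild hmeas hrdss hTI)

end Summit.NavierStokesRegularity.NavierStokesRegularity.Theorems

end
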